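/-
Copyright: the b2b-balaban T⁴-continuum CRUX team, row NE7b OWNER lineage `t4-ne7b-p1` (gen 131). Project licence.
-/
import Summits.QuantumFields.BalabanUV.T4Continuum.Spine.NE7b.SupActivityPolymerGas
import Mathlib.Order.CompleteLattice.Finset

/-!
# POLYMER-LOCAL PERTURBATIONS ARE POLYMER GASES — THE SET-INDEXED INSTANCE OF (287): for a finite-range dependent reference process with
# cell σ-algebras `𝓕_p` (cell adjacency `R`) and a finite family `𝒳` of cell SETS carrying factors `f_X` measurable in the cells of `X`
# (the Mayer factors `e^{−K_X} − 1` of a polymer-local perturbation `Σ_X K_X`), the perturbed partition function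
#   `Z(𝒳) = ∫ ∏_{X∈𝒳}(1 + f_X) dμ = Ξ(𝒫(𝒳); M)`
# is the hard-core gas of the nonempty TOUCH-connected subfamilies `𝒜 ⊆ 𝒳` (two sets are adjacent when they touch: share a cell or have
# `R`-adjacent cells), with the geometric incompatibility of families and the activity `M(𝒜) = ∫∏_{X∈𝒜}f_X dμ` — (287)
# `act_pertZ_eq_polymerPartitionFunction` with the cell index `V` replaced by `Finset V`, the σ-algebra of a set the join of its cells'
# σ-algebras, and the independence of non-touching FAMILIES OF SETS read off the independence of non-touching cell sets: the first line of
# SCOPING-d5's polymer-local input class (row NE7b, node U5c; (287) + the tree's `Finset.iSup_biUnion` BY NAME; [folklore])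

Cell `pub-balaban`, sub-cell `t4`, spine estimate NE7b (`T4WeightBudget.RelWeightBound`; the cell's OWN estimate — NOT PRINTED in
[Bałaban 1983–89], NOT PROVED).  Crux-route work under `Spine/NE7b/` by the row OWNER (`t4-ne7b-p1` gen 131, file (348)) under FREEZE
(0)'s crux-prover clause, on `g131/records/SCOPING-d5-reentry.md` DECISION (1)–(2) («the polymer-local input class; (287)'s algebra
transfers by instantiating the cell index with cell SETS»); NOTHING of Bałaban's is named as a Lean object, valued or asserted; no
`T4Continuum/Support` leaf typed; no `def`, no notation; zero `sorry`.  Imports (BY NAME): the OWNER's (287) `…SupActivityPolymerGas`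
(`act_pertZ_eq_polymerPartitionFunction`, `act_cellActivity_union`); the tree's `pertZ`, `cellActivity`, `Touches`, `GeomInc`, `rconnSubsets`,
`polymerPartitionFunction`; Mathlib's `Finset.iSup_biUnion`.

WHAT IS PROVED ([folklore]):
* §1 `touches_symm` (touching of sets is symmetric for symmetric `R`), `iSup_sets_eq_iSup_cells` (`⨆_{X∈𝒦}⨆_{p∈X}𝓕_p = ⨆_{p∈⋃𝒦}𝓕_p`),
  `not_touches_biUnion` (families of sets that do not touch AS FAMILIES have non-touching unions), **`indep_of_not_touches_families`**
  (⟹ their joint σ-algebras are independent), `le_of_sets` (the set σ-algebras are sub-σ-algebras);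
* §2 THE END **`setPertZ_eq_polymerPartitionFunction`** (`∫∏_{X∈𝒳}(1 + f_X)dμ = Ξ(𝒫(𝒳); M)` for touch-connected subfamilies) and
  **`setActivity_union`** (`M(𝒜₁ ∪ 𝒜₂) = M(𝒜₁)M(𝒜₂)` for non-touching families); §3 toy.

HONEST (what this is NOT).  The ALGEBRA of the polymer-local input class only: (287)'s SMALLNESS layer (bounded-degree Kotecký–Preiss with one
`ε` per vertex) does NOT transfer to set-vertices (their touch-degree is volume-dependent and the smallness must be `ε^{#X}`); the weighted KP
criterion of the tree's `ClusterExpansion` ∕ `ClusterExpansionKPBound` is the successor's next file (SCOPING-d5 (3b)); scalar skeleton ((A3),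
NC-NE7b-α UNRULED); nothing of Bałaban's asserted.  BY-NAME EFFECT ON THE WALL: NONE.  NE7b NOT PRINTED ∕ NOT PROVED; spine PROVED 0∕9; rung
(B)+1 — the programme's measures remain FINITE-torus statements; NOT the mass gap, NOT Clay.  HONEST DEPENDENCY: continuum YM on T⁴ ⇐
BetaPertH ∧ nine spine estimates (0∕9 proved); BetaPertH ⇐ (D1) ∧ (D4) ∧ CAP+tail; G-an2-4 gates asym, D1 and NE2∕3∕4.
-/

set_option autoImplicit false

noncomputable section

namespace Summit.QuantumFields.BalabanUV.T4Continuum.NE7b.SupPolymerLocalGas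

open MeasureTheory ProbabilityTheory Finset
open scoped BigOperators
open Literature.Probability.LatticeModels
open SupActivityPolymerGas (act_pertZ_eq_polymerPartitionFunction act_cellActivity_union)

variable {V : Type*} [DecidableEq V] {Ω : Type*} {mΩ : MeasurableSpace Ω} {μ : Measure Ω}
  {R : V → V → Prop} {𝓕 : V → MeasurableSpace Ω}

/-! ## §1. Families of sets: touching, σ-algebras, independence -/

omit [DecidableEq V] in
/-- Touching of cell sets is symmetric for symmetric `R`. [folklore] -/
theorem touches_symm (hR : ∀ x y, R x y → R y x) (X Y : Finset V) (h : Touches R X Y) : Touches R Y X := by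
  obtain ⟨w, hw, q, hq, hwq⟩ := h
  refine ⟨q, hq, w, hw, ?_⟩
  rcases hwq with rfl | hr
  · exact Or.inl rfl
  · exact Or.inr (hR _ _ hr)

/-- The join over a family of sets of the joins over their cells is the join over the union of the cells. [folklore] -/
theorem iSup_sets_eq_iSup_cells (𝒦 : Finset (Finset V)) : (⨆ X ∈ 𝒦, ⨆ p ∈ X, 𝓕 p) = ⨆ p ∈ 𝒦.biUnion id, 𝓕 p := by
  rw [Finset.iSup_biUnion]
  rfl

omit [DecidableEq V] in
/-- Families of sets that do not touch AS FAMILIES (no two members equal-or-touching) have members that pairwise do not touch. [folklore] -/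
theorem not_touches_of_families {𝒦₁ 𝒦₂ : Finset (Finset V)} (h : ¬ Touches (Touches R) 𝒦₁ 𝒦₂) {X Y : Finset V} (hX : X ∈ 𝒦₁)
    (hY : Y ∈ 𝒦₂) : ¬ Touches R X Y := fun hXY => h ⟨X, hX, Y, hY, Or.inr hXY⟩

/-- … hence non-touching UNIONS. [folklore] -/
theorem not_touches_biUnion {𝒦₁ 𝒦₂ : Finset (Finset V)} (h : ¬ Touches (Touches R) 𝒦₁ 𝒦₂) :
    ¬ Touches R (𝒦₁.biUnion id) (𝒦₂.biUnion id) := by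
  rintro ⟨w, hw, q, hq, hwq⟩
  obtain ⟨X, hX, hwX⟩ := mem_biUnion.1 hw
  obtain ⟨Y, hY, hqY⟩ := mem_biUnion.1 hq
  exact not_touches_of_families h hX hY ⟨w, hwX, q, hqY, hwq⟩

/-- **INDEPENDENCE OF NON-TOUCHING FAMILIES OF SETS** from the independence of non-touching cell sets. [folklore] -/
theorem indep_of_not_touches_families
    (hindep : ∀ K₁ K₂ : Finset V, ¬ Touches R K₁ K₂ → Indep (⨆ p ∈ K₁, 𝓕 p) (⨆ p ∈ K₂, 𝓕 p) μ)
    (𝒦₁ 𝒦₂ : Finset (Finset V)) (h : ¬ Touches (Touches R) 𝒦₁ 𝒦₂) :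
    Indep (⨆ X ∈ 𝒦₁, ⨆ p ∈ X, 𝓕 p) (⨆ X ∈ 𝒦₂, ⨆ p ∈ X, 𝓕 p) μ := by
  rw [iSup_sets_eq_iSup_cells, iSup_sets_eq_iSup_cells]
  exact hindep _ _ (not_touches_biUnion h)

omit [DecidableEq V] in
/-- The σ-algebra of a set of cells is a sub-σ-algebra. [folklore] -/
theorem le_of_sets (hle : ∀ p, 𝓕 p ≤ mΩ) (X : Finset V) : (⨆ p ∈ X, 𝓕 p) ≤ mΩ :=
  iSup₂_le fun p _ => hle p

/-! ## §2. THE END: the set-indexed polymer representation -/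

/-- **POLYMER-LOCAL PERTURBATIONS ARE POLYMER GASES.**  A probability measure with cell σ-algebras `𝓕_p ≤ mΩ` independent across
non-touching cell sets (`R` symmetric, decidable), set factors `f_X` measurable in `⨆_{p∈X}𝓕_p` with integrable products ⟹ for every finite
family `𝒳` of cell sets, `∫∏_{X∈𝒳}(1 + f_X)dμ = Ξ(𝒫(𝒳); M)`: the hard-core gas of the nonempty touch-connected subfamilies of `𝒳` with the
geometric incompatibility (equal or touching families) and activity `M(𝒜) = ∫∏_{X∈𝒜}f_X dμ`. [folklore] -/
theorem setPertZ_eq_polymerPartitionFunction [IsProbabilityMeasure μ] [DecidableRel R] (hR : ∀ x y, R x y → R y x)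
    (hle : ∀ p, 𝓕 p ≤ mΩ) (hindep : ∀ K₁ K₂ : Finset V, ¬ Touches R K₁ K₂ → Indep (⨆ p ∈ K₁, 𝓕 p) (⨆ p ∈ K₂, 𝓕 p) μ)
    {f : Finset V → Ω → ℂ} (hmeas : ∀ X, Measurable[⨆ p ∈ X, 𝓕 p] (f X))
    (hint : ∀ 𝒜 : Finset (Finset V), Integrable (fun ω => ∏ X ∈ 𝒜, f X ω) μ) (𝒳 : Finset (Finset V)) :
    pertZ μ f 𝒳 = polymerPartitionFunction (GeomInc (Touches R)) (cellActivity μ f) (rconnSubsets (Touches R) 𝒳) :=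
  act_pertZ_eq_polymerPartitionFunction (𝓕 := fun X : Finset V => ⨆ p ∈ X, 𝓕 p) (fun X Y h => touches_symm hR X Y h)
    (fun X => le_of_sets hle X) (fun 𝒦₁ 𝒦₂ h => indep_of_not_touches_families hindep 𝒦₁ 𝒦₂ h) hmeas hint 𝒳

/-- **THE ACTIVITIES FACTOR OVER NON-TOUCHING FAMILIES**: `M(𝒜₁ ∪ 𝒜₂) = M(𝒜₁)·M(𝒜₂)` when no set of `𝒜₁` equals or touches a set of `𝒜₂`. [folklore] -/
theorem setActivity_union (hle : ∀ p, 𝓕 p ≤ mΩ)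
    (hindep : ∀ K₁ K₂ : Finset V, ¬ Touches R K₁ K₂ → Indep (⨆ p ∈ K₁, 𝓕 p) (⨆ p ∈ K₂, 𝓕 p) μ)
    {f : Finset V → Ω → ℂ} (hmeas : ∀ X, Measurable[⨆ p ∈ X, 𝓕 p] (f X)) {𝒜₁ 𝒜₂ : Finset (Finset V)}
    (h : ¬ Touches (Touches R) 𝒜₁ 𝒜₂) :
    cellActivity μ f (𝒜₁ ∪ 𝒜₂) = cellActivity μ f 𝒜₁ * cellActivity μ f 𝒜₂ :=
  act_cellActivity_union (𝓕 := fun X : Finset V => ⨆ p ∈ X, 𝓕 p) (fun X => le_of_sets hle X)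
    (fun 𝒦₁ 𝒦₂ h' => indep_of_not_touches_families hindep 𝒦₁ 𝒦₂ h') hmeas h

/-! ## §3. Toy -/

/-- Toy (§1): on `Fin 3` with the adjacency `a + 1 = b ∨ b + 1 = a` of values, `{0}` touches `{1}`. -/
example : Touches (fun a b : Fin 3 => a.val + 1 = b.val ∨ b.val + 1 = a.val) ({0} : Finset (Fin 3)) {1} :=
  ⟨0, mem_singleton_self 0, 1, mem_singleton_self 1, Or.inr (Or.inl rfl)⟩

end Summit.QuantumFields.BalabanUV.T4Continuum.NE7b.SupPolymerLocalGas
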